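import Literature.MathematicalPhysics.StatisticalMechanics.NJLThermodynamicLimit
import HarnessLib

/-!
# Exponential clustering of the NJL two-point function at large mass
# (Salmhofer–Seiler, CMP 139 (1991), Thm. 3.11 — the large-mass input, uniformly in the volume)

Salmhofer–Seiler, p. 407: **Theorem 3.11.** "In the NJL system exponential clustering holds for all
`m ∈ 𝒲`. More specifically, if `w₁ = 1`, `|⟨σ_{x₁} ⋯ σ_{x_n}⟩^T| ≤ C(n) e^{-κ(m) ϑ(x₁,…,x_n)}` (3.32),
where `κ(m) > 0` for all `m ∈ 𝒲`, `⟨·⟩^T` is the truncated expectation value and `ϑ(x₁,…,x_n)` is the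
length of a minimal tree on `{x₁,…,x_n}`."  Printed proof (p. 408): `u_L = ϑ(L)⁻¹ log(|F(L,m)|/C(L))`
is subharmonic in `m` and nonpositive; "For `|m| > m₀`, the cluster expansion converges and the
truncated correlations decay exponentially, `u_L(m) ≤ -K(m) < 0` for all `L`"; the Poisson kernel
and Fatou's lemma then spread strict negativity of `u = limsup u_L` from `{|m| > m₀}` to all of `𝒲`.

This file proves the LARGE-MASS INPUT of that argument for the two-point function, uniformly in the
volume and with an explicit rate, WITHOUT the cluster expansion — from the locality of the hopping
expansion (`NJLHoppingLocality`) and the Schwarz lemma of order `n`, exactly as Thm. 3.8 was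
obtained in `NJLThermodynamicLimit`:

* `njl_twoPoint_clustering` — for the NJL system with `N ≥ 1` colours on the torus `(ℤ/Lℤ)^ν`
  (`ν ≥ 1`), lattice points `x, y` whose torus distance in some coordinate direction is `≥ D ≥ 1`
  (`D ≤ |x_i - y_i|`, `|x_i - y_i| + D ≤ L`), and every complex mass with `|m| > √(2ν)`:
  `|⟨σ_x σ_y⟩_Λ(m) - ⟨σ_x⟩_Λ(m) ⟨σ_y⟩_Λ(m)| ≤ 2 (√(2ν)/|m|)^{2D}` — exponential clustering with rate
  `κ(m) = 2 log(|m|/√(2ν)) > 0` per unit of distance, the constant `2` and the rate independent of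
  `N`, `L`, `x`, `y`.  Mechanism: `⟨σ_xσ_y⟩ - ⟨σ_x⟩⟨σ_y⟩ = ρ(x, N)·(ρ(y, N - δ_x) - ρ(y, N))` and the
  capacities `N - δ_x`, `N` agree on the box of radius `D - 1` around `y`, so by
  `njlCapRatio_locality` the bracket is `O(|m|^{-(2D-1)})`, the product `O(|m|^{-2D})`, i.e. the
  hopping-parameter expansion of the truncated function starts at order `K^{2D}`; the uniform
  majorant `1` on the hopping disc `|K| < (2√(2ν))⁻¹` and Mathlib's Schwarz lemma
  (`Complex.dist_le_mul_div_pow_of_mapsTo_ball_of_isLittleO`) give `≤ 2(|K|/r₀)^{2D}`,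
  and `|K|/r₀ = √(2ν)/|m|`.
* `njl_twoPoint_clustering_limit` — the same bound for the thermodynamic limits of Thm. 3.8
  (`NJLThermodynamicLimit`), with `D = |x_i - y_i|` for any direction `i`.

Faithfulness / scope.  This is Thm. 3.11 for `n = 2` on the sub-region `{|m| > √(2ν)} ⊆ 𝒲`-plus
(the tree's normalisation; the printed cluster-expansion region is `{|m| > m₀}`), in finite volume
uniformly and in the limit; the extension of strict exponential decay to ALL of `𝒲` by
subharmonicity ((3.35)–(3.42)) and the `n`-point truncated functions with the tree length `ϑ` are
NOT formalised here.  `β = 0` NJL statements on tori only; nothing about `β > 0`, the continuum, a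
mass gap or the summit's `QCD` conjunct.

## References

* M. Salmhofer, E. Seiler, *Proof of chiral symmetry breaking in strongly coupled lattice gauge
  theory*, Commun. Math. Phys. 139 (1991) 395–432: Thm. 3.11 (3.32) p. 407 and its proof
  (3.33)–(3.42) p. 408–409, Remark 3.10, Remark 3.12. [SalmhoferSeiler1991]
* M. Salmhofer, E. Seiler, Erratum, Commun. Math. Phys. 146 (1992) 637–638 (the bound
  `|⟨σ^L⟩_Λ| ≤ 1` holds for real `m` only; constants `C(L)` for complex `m`). [SalmhoferSeiler1992Erratum]
* O. J. Heilmann, E. H. Lieb, *Theory of monomer-dimer systems*, Commun. Math. Phys. 25 (1972)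
  190–232: (4.20), Lemma 4.4. [HeilmannLieb1972]
-/

noncomputable section

open Filter Asymptotics Bornology Topology Metric Set

namespace Literature.MathematicalPhysics.StatisticalMechanics

namespace ComplexSpin

open Literature.Probability.LatticeModels (TorusSite Site)
open Literature.Probability.LatticeModels

variable {ν : ℕ}

/-! ### Large-mass plumbing (local copies) -/

/-- Eventually along `|m| → ∞`: `‖m‖ ≥ √(2ν)` and `‖m‖ ≥ 1`. [folklore] -/
private theorem eventually_norm_ge' (ν : ℕ) :
    ∀ᶠ m : ℂ in cobounded ℂ, Real.sqrt (2 * ν) ≤ ‖m‖ ∧ 1 ≤ ‖m‖ := by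
  have h := (tendsto_norm_cobounded_atTop (E := ℂ)).eventually
    (eventually_ge_atTop (max (Real.sqrt (2 * ν)) 1))
  exact h.mono fun m hm => ⟨(le_max_left _ _).trans hm, (le_max_right _ _).trans hm⟩

/-- A complex number of norm `≥ 1` is nonzero. [folklore] -/
private theorem ne_zero_of_one_le_norm' {m : ℂ} (hm : 1 ≤ ‖m‖) : m ≠ 0 := by
  rintro rfl
  rw [norm_zero] at hm
  exact absurd hm (by norm_num)

/-- `K ↦ 1/(2K)` sends the punctured neighbourhood of `0` to `|m| → ∞`. [folklore] -/
private theorem tendsto_inv_two_mul' :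
    Tendsto (fun K : ℂ => (2 * K)⁻¹) (𝓝[≠] (0 : ℂ)) (cobounded ℂ) := by
  have h2 : Tendsto (fun K : ℂ => 2 * K) (𝓝[≠] (0 : ℂ)) (𝓝[≠] (0 : ℂ)) := by
    refine tendsto_nhdsWithin_iff.2 ⟨?_, ?_⟩
    · have : Tendsto (fun K : ℂ => 2 * K) (𝓝 0) (𝓝 (2 * 0)) :=
        (continuous_const.mul continuous_id).tendsto 0
      rw [mul_zero] at this
      exact this.mono_left nhdsWithin_le_nhds
    · filter_upwards [self_mem_nhdsWithin] with K hK
      exact mul_ne_zero two_ne_zero hK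
  exact tendsto_inv₀_nhdsNE_zero.comp h2

/-! ### The two points on the torus -/

section TwoPoints

variable {L : ℕ} {x y : Site ν} {i : Fin ν} {D : ℕ}

/-- Separation on the torus: if `D ≤ |x_i - y_i|` and `|x_i - y_i| + D ≤ L` then no lattice vector
`v` with `|v|_∞ ≤ D - 1` has `y + v ≡ x` on the torus `(ℤ/Lℤ)^ν`. [cite: FriedliVelenik2017, §3.1] -/
theorem proj_add_ne_of_separated (hD : (D : ℤ) ≤ |x i - y i|) (hL : |x i - y i| + (D : ℤ) ≤ L)
    {v : Site ν} (hv : ∀ j, |v j| ≤ ((D - 1 : ℕ) : ℤ)) (hD1 : 1 ≤ D) :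
    Torus.proj L y + Torus.proj L v ≠ Torus.proj L x := by
  intro h
  have hi := congr_fun h i
  simp only [Pi.add_apply, Torus.proj_apply] at hi
  rw [← Int.cast_add, ZMod.intCast_eq_intCast_iff_dvd_sub] at hi
  -- `L ∣ x_i - (y_i + v_i)` with `0 < |x_i - (y_i + v_i)| < L`
  have hvi := abs_le.1 (hv i)
  have hD1' : ((D - 1 : ℕ) : ℤ) = D - 1 := by omega
  rw [hD1'] at hvi
  have hxy := abs_le.1 (le_refl |x i - y i|)
  have hne : x i - (y i + v i) ≠ 0 := by
    intro h0
    have : |x i - y i| ≤ (D : ℤ) - 1 := by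
      rw [show x i - y i = v i by linarith]; exact hv i |>.trans (le_of_eq hD1')
    linarith
  have hlt : |x i - (y i + v i)| < (L : ℤ) := by
    calc |x i - (y i + v i)| = |(x i - y i) - v i| := by ring_nf
      _ ≤ |x i - y i| + |v i| := abs_sub _ _
      _ < L := by
          have : |v i| ≤ (D : ℤ) - 1 := abs_le.2 ⟨by linarith, by linarith⟩
          linarith
  exact hne (Int.eq_zero_of_abs_lt_dvd hi hlt)

/-- The two points are distinct on the torus. [cite: FriedliVelenik2017, §3.1] -/
theorem proj_ne_of_separated (hD : (D : ℤ) ≤ |x i - y i|) (hL : |x i - y i| + (D : ℤ) ≤ L)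
    (hD1 : 1 ≤ D) : Torus.proj L y ≠ Torus.proj L x := by
  have h := proj_add_ne_of_separated hD hL (v := 0) (fun j => by simp) hD1
  have h0 : Torus.proj L (0 : Site ν) = 0 := by funext j; simp
  rwa [h0, add_zero] at h

variable [NeZero L]

/-- **The capacities `N - δ_x` and `N` agree on the box of radius `D - 1` around `y`.**
[cite: SalmhoferSeiler1991, Remark 3.10] -/
theorem capAgree_top_sub_single (N : ℕ) (hD : (D : ℤ) ≤ |x i - y i|)
    (hL : |x i - y i| + (D : ℤ) ≤ L) (hD1 : 1 ≤ D) :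
    CapAgree (D - 1) (Torus.proj L y) (topExponent N - Finsupp.single (Torus.proj L x) 1)
      (Torus.proj L y) (topExponent (ν := ν) (L := L) N) := by
  intro v hv
  rw [Finsupp.tsub_apply, topExponent_apply', Finsupp.single_apply,
    if_neg (proj_add_ne_of_separated hD hL hv hD1).symm, tsub_zero]

end TwoPoints

/-! ### The truncated two-point function as a product of ratios -/

section Truncated

variable {L : ℕ}

/-- The two-point multi-index `δ_x + δ_y` read on the torus. [cite: SalmhoferSeiler1991, (3.30)] -/
private theorem mapDomain_proj_pair (x y : Site ν) :
    Finsupp.mapDomain (Torus.proj L) (Finsupp.single x 1 + Finsupp.single y 1) =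
      Finsupp.single (Torus.proj L x) 1 + Finsupp.single (Torus.proj L y) 1 := by
  rw [Finsupp.mapDomain_add, Finsupp.mapDomain_single, Finsupp.mapDomain_single]

variable [NeZero L]

/-- Two distinct unit indices fit under the capacities `N ≥ 1`. [cite: SalmhoferSeiler1991, Remark 3.2] -/
private theorem pair_le_topExponent {N : ℕ} (hN : 1 ≤ N) {a b : TorusSite ν L} (hab : a ≠ b) :
    Finsupp.single a 1 + Finsupp.single b 1 ≤ topExponent (ν := ν) (L := L) N := by
  intro z
  rw [Finsupp.add_apply, topExponent_apply', Finsupp.single_apply, Finsupp.single_apply]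
  by_cases h1 : a = z
  · rw [if_pos h1, if_neg (fun h2 => hab (h1.trans h2.symm))]; omega
  · rw [if_neg h1]; split_ifs <;> omega

/-- A unit index fits under the capacities `N ≥ 1`. [cite: SalmhoferSeiler1991, Remark 3.2] -/
private theorem single_le_topExponent {N : ℕ} (hN : 1 ≤ N) (a : TorusSite ν L) :
    Finsupp.single a 1 ≤ topExponent (ν := ν) (L := L) N := by
  intro z
  rw [topExponent_apply', Finsupp.single_apply]
  split_ifs <;> omega

/-- `⟨σ_a⟩_Λ(m) = ρ_Λ(a, N)(m)`: the one-point function is a one-step ratio. [cite: SalmhoferSeiler1991, Remark 3.2 and (3.46)] -/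
theorem njlCorrelation_single_eq_njlCapRatio {N : ℕ} (hN : 1 ≤ N) (a : Site ν) (m : ℂ) :
    njlCorrelation N L (Finsupp.single a 1) m =
      njlCapRatio N (Torus.proj L a) (topExponent (ν := ν) (L := L) N) m := by
  unfold njlCorrelation njlExpectC njlCapRatio njlCapZ
  rw [njlBracketC_monomial, njlPartitionFunctionC_eq_Z, Finsupp.mapDomain_single,
    if_pos (single_le_topExponent hN _)]

/-- `⟨σ_aσ_b⟩_Λ(m) = Z_Λ(N - δ_a - δ_b)(m)/Z_Λ(N)(m)` for distinct `a, b`. [cite: SalmhoferSeiler1991, Remark 3.2 and (3.30)] -/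
theorem njlCorrelation_pair_eq_div {N : ℕ} (hN : 1 ≤ N) {x y : Site ν}
    (hxy : Torus.proj L y ≠ Torus.proj L x) (m : ℂ) :
    njlCorrelation N L (Finsupp.single x 1 + Finsupp.single y 1) m =
      njlCapZ N (topExponent N - Finsupp.single (Torus.proj L x) 1 - Finsupp.single (Torus.proj L y) 1) m /
        njlCapZ N (topExponent (ν := ν) (L := L) N) m := by
  unfold njlCorrelation njlExpectC njlCapZ
  rw [njlBracketC_monomial, njlPartitionFunctionC_eq_Z, mapDomain_proj_pair,
    if_pos (pair_le_topExponent hN hxy.symm), tsub_add_eq_tsub_tsub]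

/-- **The truncated two-point function as a product of ratios**: in the zero-free region
`⟨σ_xσ_y⟩_Λ - ⟨σ_x⟩_Λ⟨σ_y⟩_Λ = ρ(x, N) · (ρ(y, N - δ_x) - ρ(y, N))`. [cite: SalmhoferSeiler1991, (3.33) and (3.46)][cite: HeilmannLieb1972, (4.20)] -/
theorem njl_truncatedTwoPoint_eq {N : ℕ} (hN : 1 ≤ N) {x y : Site ν}
    (hxy : Torus.proj L y ≠ Torus.proj L x) {m : ℂ} (hm0 : m ≠ 0) (hm : Real.sqrt (2 * ν) ≤ ‖m‖) :
    njlCorrelation N L (Finsupp.single x 1 + Finsupp.single y 1) m -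
        njlCorrelation N L (Finsupp.single x 1) m * njlCorrelation N L (Finsupp.single y 1) m =
      njlCapRatio N (Torus.proj L x) (topExponent (ν := ν) (L := L) N) m *
        (njlCapRatio N (Torus.proj L y) (topExponent N - Finsupp.single (Torus.proj L x) 1) m -
          njlCapRatio N (Torus.proj L y) (topExponent (ν := ν) (L := L) N) m) := by
  have htop : ∀ z, topExponent (ν := ν) (L := L) N z ≤ N := fun z => (topExponent_apply' N z).le
  have hc' : ∀ z, (topExponent (ν := ν) (L := L) N - Finsupp.single (Torus.proj L x) 1 :
      TorusSite ν L →₀ ℕ) z ≤ N :=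
    fun z => by rw [Finsupp.tsub_apply]; exact (Nat.sub_le _ _).trans (htop z)
  have hZ' : njlCapZ N (topExponent (ν := ν) (L := L) N - Finsupp.single (Torus.proj L x) 1) m ≠ 0 :=
    njlCapZ_ne_zero hN hc' hm0 hm
  have hZ : njlCapZ N (topExponent (ν := ν) (L := L) N) m ≠ 0 := njlCapZ_ne_zero hN htop hm0 hm
  rw [njlCorrelation_pair_eq_div hN hxy, njlCorrelation_single_eq_njlCapRatio hN,
    njlCorrelation_single_eq_njlCapRatio hN]
  unfold njlCapRatio
  field_simp

end Truncated

/-! ### Theorem 3.11 (two-point function) at large mass -/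

/-- **The truncated two-point function is `O(|m|^{-2D})`** (locality): for lattice points whose torus
distance in direction `i` is at least `D ≥ 1` (`D ≤ |x_i - y_i|`, `|x_i - y_i| + D ≤ L`),
`⟨σ_xσ_y⟩_Λ(m) - ⟨σ_x⟩_Λ(m)⟨σ_y⟩_Λ(m) = O(|m|^{-2D})` as `|m| → ∞` — its hopping expansion starts
at order `2D`. [cite: SalmhoferSeiler1991, Thm. 3.11 (proof, p. 408) and Remark 3.10] -/
theorem njl_truncatedTwoPoint_isBigO {N : ℕ} (hN : 1 ≤ N) {L : ℕ} [NeZero L] {x y : Site ν}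
    {i : Fin ν} {D : ℕ} (hD1 : 1 ≤ D) (hD : (D : ℤ) ≤ |x i - y i|) (hL : |x i - y i| + (D : ℤ) ≤ L) :
    (fun m => njlCorrelation N L (Finsupp.single x 1 + Finsupp.single y 1) m -
        njlCorrelation N L (Finsupp.single x 1) m * njlCorrelation N L (Finsupp.single y 1) m)
      =O[cobounded ℂ] fun m : ℂ => (‖m‖⁻¹ ^ (2 * D) : ℝ) := by
  have hxy : Torus.proj L y ≠ Torus.proj L x := proj_ne_of_separated hD hL hD1
  have htop : ∀ z, topExponent (ν := ν) (L := L) N z ≤ N := fun z => (topExponent_apply' N z).le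
  have hc' : ∀ z, (topExponent (ν := ν) (L := L) N - Finsupp.single (Torus.proj L x) 1 :
      TorusSite ν L →₀ ℕ) z ≤ N :=
    fun z => by rw [Finsupp.tsub_apply]; exact (Nat.sub_le _ _).trans (htop z)
  have hL' : 2 * (D - 1) < L := by
    have h1 : (D : ℤ) + D ≤ L := by linarith
    have h2 : D + D ≤ L := by exact_mod_cast h1
    omega
  have hxsupp : Torus.proj L x ∈ (topExponent (ν := ν) (L := L) N).support := by
    rw [Finsupp.mem_support_iff, topExponent_apply']; omega
  have hysupp : Torus.proj L y ∈
      (topExponent (ν := ν) (L := L) N - Finsupp.single (Torus.proj L x) 1).support := by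
    rw [Finsupp.mem_support_iff, Finsupp.tsub_apply, topExponent_apply', Finsupp.single_apply,
      if_neg hxy.symm]
    omega
  -- the bracket: locality to order `2D - 1`
  have hbr := njlCapRatio_locality hN (2 * D - 1) (D - 1) (Torus.proj L y)
    (topExponent N - Finsupp.single (Torus.proj L x) 1) (Torus.proj L y) (topExponent N) hc' htop
    (capAgree_top_sub_single N hD hL hD1) (by omega) hL' hL' hysupp
  -- the prefactor: `O(|m|^{-1})`
  have hρ := njlCapRatio_isBigO hN htop hxsupp
  have hprod := (hρ.mul hbr).congr_right (g₂ := fun m : ℂ => (‖m‖⁻¹ ^ (2 * D) : ℝ)) fun m => by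
    rw [← pow_add]; congr 1; omega
  refine hprod.congr' ?_ EventuallyEq.rfl
  filter_upwards [eventually_norm_ge' ν] with m hm
  exact (njl_truncatedTwoPoint_eq hN hxy (ne_zero_of_one_le_norm' hm.2) hm.1).symm

/-- **Theorem 3.11 for the two-point function at large mass, uniformly in the volume.**  For the NJL
system with `N ≥ 1` colours on the torus `(ℤ/Lℤ)^ν`, `ν ≥ 1`, lattice points `x, y` whose torus
distance in direction `i` is at least `D ≥ 1` (`D ≤ |x_i - y_i|` and `|x_i - y_i| + D ≤ L`), and every
complex mass with `|m| > √(2ν)`: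
`|⟨σ_xσ_y⟩_Λ(m) - ⟨σ_x⟩_Λ(m)⟨σ_y⟩_Λ(m)| ≤ 2 (√(2ν)/|m|)^{2D}` — exponential clustering with rate
`κ(m) = 2 log(|m|/√(2ν)) > 0`, the constant and the rate independent of `N`, `Λ`, `x`, `y` (the
"`u_L(m) ≤ -K(m) < 0` for all `L`, `|m| > m₀`" of the printed proof, here from locality + Schwarz
instead of the cluster expansion). [cite: SalmhoferSeiler1991, Thm. 3.11 and its proof p. 408][cite: SalmhoferSeiler1992Erratum, (5)] -/
theorem njl_twoPoint_clustering {N : ℕ} (hN : 1 ≤ N) (hν : 1 ≤ ν) {L : ℕ} [NeZero L]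
    {x y : Site ν} {i : Fin ν} {D : ℕ} (hD1 : 1 ≤ D) (hD : (D : ℤ) ≤ |x i - y i|)
    (hL : |x i - y i| + (D : ℤ) ≤ L) {m : ℂ} (hm : Real.sqrt (2 * ν) < ‖m‖) :
    ‖njlCorrelation N L (Finsupp.single x 1 + Finsupp.single y 1) m -
        njlCorrelation N L (Finsupp.single x 1) m * njlCorrelation N L (Finsupp.single y 1) m‖ ≤
      2 * (Real.sqrt (2 * ν) / ‖m‖) ^ (2 * D) := by
  set r₀ : ℝ := (2 * Real.sqrt (2 * (ν : ℝ)))⁻¹ with hr₀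
  have hr₀pos : 0 < r₀ := hoppingRadius_pos hν
  have hνpos : (0 : ℝ) < ν := by exact_mod_cast Nat.lt_of_lt_of_le Nat.zero_lt_one hν
  have hs : 0 < Real.sqrt (2 * ν) := Real.sqrt_pos.2 (by positivity)
  have hm0 : m ≠ 0 := by
    intro h; rw [h, norm_zero] at hm; linarith
  have hmpos : 0 < ‖m‖ := norm_pos_iff.2 hm0
  -- the three hopping functions and their truncated combination
  set dxy : Site ν →₀ ℕ := Finsupp.single x 1 + Finsupp.single y 1 with hdxy
  set G : ℂ → ℂ := fun K => njlHopping N L dxy K -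
    njlHopping N L (Finsupp.single x 1) K * njlHopping N L (Finsupp.single y 1) K with hG
  have hdx0 : (Finsupp.single x 1 : Site ν →₀ ℕ) ≠ 0 := by
    intro h; have := congrArg (fun f => f x) h; simp at this
  have hdxy0 : dxy ≠ 0 := by
    intro h; have := congrArg (fun f => f x) h
    simp only [hdxy, Finsupp.coe_add, Pi.add_apply, Finsupp.single_eq_same, Finsupp.coe_zero,
      Pi.zero_apply] at this
    omega
  have hG0 : G 0 = 0 := by
    simp [hG, njlHopping_zero, hdx0, hdxy0]
  have hGd : DifferentiableOn ℂ G (ball 0 r₀) :=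
    (differentiableOn_njlHopping hN L dxy).sub
      ((differentiableOn_njlHopping hN L _).mul (differentiableOn_njlHopping hN L _))
  have hmaps : MapsTo G (ball 0 r₀) (closedBall (G 0) 2) := by
    intro w hw
    rw [mem_ball_zero_iff] at hw
    rw [mem_closedBall, hG0, dist_zero_right]
    have h1 := norm_njlHopping_le_one hN hν L dxy hw
    have h2 := norm_njlHopping_le_one hN hν L (Finsupp.single x 1) hw
    have h3 := norm_njlHopping_le_one hN hν L (Finsupp.single y 1) hw
    calc ‖G w‖ ≤ ‖njlHopping N L dxy w‖ +
          ‖njlHopping N L (Finsupp.single x 1) w * njlHopping N L (Finsupp.single y 1) w‖ :=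
          norm_sub_le _ _
      _ ≤ 1 + 1 * 1 := by
          rw [norm_mul]
          exact add_le_add h1 (mul_le_mul h2 h3 (norm_nonneg _) zero_le_one)
      _ = 2 := by norm_num
  -- `G = O(K^{2D})` at `0`: locality read in the hopping parameter
  have hO : G =O[𝓝[≠] (0 : ℂ)] fun K : ℂ => K ^ (2 * D) := by
    have h := (njl_truncatedTwoPoint_isBigO hN hD1 hD hL).comp_tendsto tendsto_inv_two_mul'
    have h' : G =O[𝓝[≠] (0 : ℂ)] fun K : ℂ => (‖(2 * K : ℂ)⁻¹‖⁻¹ ^ (2 * D) : ℝ) := by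
      refine h.congr' ?_ EventuallyEq.rfl
      filter_upwards [self_mem_nhdsWithin] with K hK
      simp only [Function.comp_apply, hG, hdxy]
      rw [njlHopping_eq_of_ne_zero N L _ hK, njlHopping_eq_of_ne_zero N L _ hK,
        njlHopping_eq_of_ne_zero N L _ hK]
    refine h'.trans (IsBigO.of_bound (2 ^ (2 * D)) (Eventually.of_forall fun K => ?_))
    rw [norm_inv, inv_inv, norm_mul, Complex.norm_two, Real.norm_of_nonneg (by positivity),
      norm_pow, mul_pow]
  -- hence `o(‖K‖^{2D-1})`, and Schwarz of order `2D - 1`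
  obtain ⟨n, hn⟩ : ∃ n, 2 * D = n + 1 := ⟨2 * D - 1, by omega⟩
  have ho : (fun K => G K - G 0) =o[𝓝 (0 : ℂ)] fun w => ‖w - 0‖ ^ n := by
    have h1 : G =o[𝓝[≠] (0 : ℂ)] fun w : ℂ => ‖w - 0‖ ^ n := by
      have hpp : (fun K : ℂ => K ^ (2 * D)) =o[𝓝[≠] (0 : ℂ)] fun K : ℂ => K ^ n :=
        (isLittleO_pow_pow (by omega : n < 2 * D)).mono nhdsWithin_le_nhds
      refine (hO.trans_isLittleO hpp).trans_isBigO (isBigO_of_le _ fun K => le_of_eq ?_)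
      rw [norm_pow, sub_zero, Real.norm_of_nonneg (by positivity)]
    have h2 : (fun K => G K - G 0) =o[𝓝[≠] (0 : ℂ)] fun w : ℂ => ‖w - 0‖ ^ n :=
      h1.congr_left fun K => by rw [hG0, sub_zero]
    have h3 := h2.insert (show G 0 - G 0 = 0 from sub_self _)
    rwa [nhdsWithin_insert, pure_sup_nhdsNE] at h3
  -- evaluate at `K = 1/(2m)`
  set K : ℂ := (2 * m)⁻¹ with hKdef
  have hK0 : K ≠ 0 := inv_ne_zero (mul_ne_zero two_ne_zero hm0)
  have hKnorm : ‖K‖ = (2 * ‖m‖)⁻¹ := by rw [hKdef]; simp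
  have hK : ‖K‖ < r₀ := by
    rw [hKnorm, hr₀]
    exact inv_strictAnti₀ (by positivity) (by linarith)
  have key := Complex.dist_le_mul_div_pow_of_mapsTo_ball_of_isLittleO hGd hmaps ho
    (mem_ball_zero_iff.2 hK)
  rw [hG0, dist_zero_right, dist_zero_right, ← hn] at key
  have hGK : G K = njlCorrelation N L dxy m -
      njlCorrelation N L (Finsupp.single x 1) m * njlCorrelation N L (Finsupp.single y 1) m := by
    have hm' : (2 * K)⁻¹ = m := by
      rw [hKdef, mul_inv, inv_inv, ← mul_assoc, inv_mul_cancel₀ (two_ne_zero' ℂ), one_mul]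
    simp only [hG]
    rw [njlHopping_eq_of_ne_zero N L _ hK0, njlHopping_eq_of_ne_zero N L _ hK0,
      njlHopping_eq_of_ne_zero N L _ hK0, hm']
  have hratio : ‖K‖ / r₀ = Real.sqrt (2 * ν) / ‖m‖ := by
    rw [hKnorm, hr₀]
    field_simp
  rw [hGK, hratio] at key
  exact key

/-- **Clustering of the thermodynamic limit** (Thm. 3.11, `n = 2`, large mass): if `⟨σ_xσ_y⟩`,
`⟨σ_x⟩`, `⟨σ_y⟩` are the `L → ∞` limits of the torus correlation functions at a mass `|m| > √(2ν)`
(they exist by Thm. 3.8, `NJLThermodynamicLimit`), then for every direction `i` with `x_i ≠ y_i`,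
`|⟨σ_xσ_y⟩ - ⟨σ_x⟩⟨σ_y⟩| ≤ 2 (√(2ν)/|m|)^{2|x_i - y_i|}`. [cite: SalmhoferSeiler1991, Thm. 3.11] -/
theorem njl_twoPoint_clustering_limit {N : ℕ} (hN : 1 ≤ N) (hν : 1 ≤ ν) {x y : Site ν} {i : Fin ν}
    (hxy : x i ≠ y i) {m : ℂ} (hm : Real.sqrt (2 * ν) < ‖m‖) {a b c : ℂ}
    (ha : Tendsto (fun L : ℕ => njlCorrelation N (L + 1) (Finsupp.single x 1 + Finsupp.single y 1) m)
      atTop (𝓝 a))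
    (hb : Tendsto (fun L : ℕ => njlCorrelation N (L + 1) (Finsupp.single x 1) m) atTop (𝓝 b))
    (hc : Tendsto (fun L : ℕ => njlCorrelation N (L + 1) (Finsupp.single y 1) m) atTop (𝓝 c)) :
    ‖a - b * c‖ ≤ 2 * (Real.sqrt (2 * ν) / ‖m‖) ^ (2 * (x i - y i).natAbs) := by
  set D := (x i - y i).natAbs with hD
  have hD1 : 1 ≤ D := by
    rw [hD]; have : x i - y i ≠ 0 := sub_ne_zero.2 hxy; omega
  have hDeq : (D : ℤ) = |x i - y i| := by rw [hD]; exact Int.natCast_natAbs _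
  have hlim : Tendsto (fun L : ℕ => njlCorrelation N (L + 1) (Finsupp.single x 1 + Finsupp.single y 1) m -
      njlCorrelation N (L + 1) (Finsupp.single x 1) m * njlCorrelation N (L + 1) (Finsupp.single y 1) m)
      atTop (𝓝 (a - b * c)) := ha.sub (hb.mul hc)
  refine le_of_tendsto ((continuous_norm.tendsto _).comp hlim) ?_
  filter_upwards [eventually_ge_atTop (2 * D)] with L hL
  have hL' : |x i - y i| + (D : ℤ) ≤ ((L + 1 : ℕ) : ℤ) := by
    rw [← hDeq]; push_cast; omega
  exact njl_twoPoint_clustering hN hν hD1 hDeq.le hL' hm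

end ComplexSpin

end Literature.MathematicalPhysics.StatisticalMechanics
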